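import Summits.CriticalPhenomena.PercolationContinuityZ3.Theorems.PercNearOneGluingNoHeavyLowerTailSahiE3LroSlot
import Summits.CriticalPhenomena.PercolationContinuityZ3.Theorems.PercNearOneGluingNoHeavyLowerTailSahiE3HitSlotProduct
import Summits.CriticalPhenomena.PercolationContinuityZ3.Theorems.PercNearOneGluingNoHeavyLowerTailSahiE3CovHit
import Mathlib.Tactic.Linarith
import Mathlib.Tactic.Ring
import Mathlib.Tactic.Positivity
import HarnessLib
import HarnessLib.Audit

/-!
# `NoHeavyLowerTail` (crux stmt-CriticalPhenomena-4575), Sahi programme P4 (Holley / monotone coupling):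
# Kahn's Conjecture 5 for every linear read-once first slot under every product weight on `2^κ`

Support file (cell `prim-l12`, seat P4, generation 11; `--supports stmt-CriticalPhenomena-4575`).  No named facts, no sorries;
standard axioms; def-free.

THEOREM `latticeE3_nonneg_lro_prod`: for a product weight `μ(ω) = ∏_{u∈ω} θ_u` (`θ ≥ 0`) on `Finset κ`, distinct
generators `v : Fin (n+1) → κ`, a linear read-once formula `F = x₀ ∘₀ (x₁ ∘₁ (⋯ xₙ))` (`∘ᵢ = ∨` iff `ops i`) and ALL
up-sets `A, B`:  `0 ≤ latticeE3 μ {ω | F((v i ∈ ω)ᵢ)} A B` — Sahi's `C₃` / Kahn's Conjecture 5 [Kahn, arXiv:2210.08653,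
Conj. 5] for the slots `x_a ∨ (x_b ∧ x_c ∧ ⋯)`, `x_a ∨ (x_b ∧ (x_c ∨ x_d))` (= `1+23+24`), … .  It is
`…SahiE3LroSlot.latticeE3_nonneg_of_lro` plus the factorisation of the pattern marginal of a product weight
(`mass_fib_prod`).  The hitting case is `…SahiE3HitSlotProduct.latticeE3_nonneg_hitting_prod` (gen 7).
-/

namespace Summit.CriticalPhenomena.PercolationContinuityZ3.Theorems.SahiE3LroCube

open Finset Literature.Probability.LatticeModels
open scoped BigOperators

variable {κ : Type*} [Fintype κ] [DecidableEq κ] {ι : Type*} [Fintype ι]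

/-- **Pattern marginals of a product weight are product weights.**  For `μ(ω) = ∏_{u∈ω} θ_u` on `2^κ` and distinct
generators `v : ι → κ`, the mass of the pattern fibre `F_t = {ω | v l ∈ ω ↔ t l}` factorises as
`(∏_l [t l] θ_{v l}) · C` with `C = Σ_{ω' ⊆ (range v)ᶜ} ∏_{u∈ω'} θ_u` (split `ω = (ω ∖ range v) ∪ v(t⁻¹ true)`). [folklore] -/
theorem mass_fib_prod (θ : κ → ℝ) {v : ι → κ} (hv : Function.Injective v)
    {F : (ι → Bool) → Finset (Finset κ)} (hF : ∀ (t : ι → Bool) (ω : Finset κ), ω ∈ F t ↔ ∀ l, (v l ∈ ω ↔ t l = true))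
    (t : ι → Bool) :
    mass (fun ω : Finset κ => ∏ u ∈ ω, θ u) (F t) =
      (∏ l, if t l = true then θ (v l) else 1) * ∑ ω ∈ ((univ : Finset ι).image v)ᶜ.powerset, ∏ u ∈ ω, θ u := by
  set K : Finset κ := (univ : Finset ι).image v with hK
  set Kt : Finset κ := (univ.filter fun l => t l = true).image v with hKt
  have hKtK : Kt ⊆ K := Finset.image_subset_image (Finset.filter_subset _ _)
  have memK : ∀ u, u ∈ K ↔ ∃ l, v l = u := fun u => by simp [hK]
  have memKt : ∀ u, u ∈ Kt ↔ ∃ l, t l = true ∧ v l = u := fun u => by simp [hKt]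
  -- the product over `Kt`
  have pKt : ∏ u ∈ Kt, θ u = ∏ l, if t l = true then θ (v l) else 1 := by
    rw [hKt, Finset.prod_image (fun a _ b _ h => hv h), Finset.prod_filter]
  unfold mass
  rw [Finset.mul_sum]
  refine Finset.sum_nbij' (fun ω => ω \ K) (fun ω' => ω' ∪ Kt) ?_ ?_ ?_ ?_ ?_
  · intro ω _
    rw [Finset.mem_powerset]
    intro u hu
    rw [Finset.mem_compl]
    exact (Finset.mem_sdiff.1 hu).2
  · intro ω' hω'
    rw [Finset.mem_powerset] at hω'
    rw [hF]
    intro l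
    rw [Finset.mem_union, memKt]
    constructor
    · rintro (h | ⟨l', hl', he⟩)
      · exact absurd ((memK (v l)).2 ⟨l, rfl⟩) (Finset.mem_compl.1 (hω' h))
      · rwa [← hv he]
    · intro h; exact Or.inr ⟨l, h, rfl⟩
  · intro ω hω
    have hω' := (hF t ω).1 hω
    ext u
    simp only [Finset.mem_union, Finset.mem_sdiff, memKt]
    constructor
    · rintro (⟨hu, -⟩ | ⟨l, hl, rfl⟩)
      · exact hu
      · exact (hω' l).2 hl
    · intro hu
      by_cases huK : u ∈ K
      · obtain ⟨l, rfl⟩ := (memK u).1 huK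
        exact Or.inr ⟨l, (hω' l).1 hu, rfl⟩
      · exact Or.inl ⟨hu, huK⟩
  · intro ω' hω'
    rw [Finset.mem_powerset] at hω'
    ext u
    simp only [Finset.mem_sdiff, Finset.mem_union]
    constructor
    · rintro ⟨h | h, huK⟩
      · exact h
      · exact absurd (hKtK h) huK
    · intro hu; exact ⟨Or.inl hu, Finset.mem_compl.1 (hω' hu)⟩
  · intro ω hω
    have hω' := (hF t ω).1 hω
    have hdisj : Disjoint Kt (ω \ K) := by
      rw [Finset.disjoint_left]; intro u hu hu'
      exact (Finset.mem_sdiff.1 hu').2 (hKtK hu)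
    have e : ω = Kt ∪ (ω \ K) := by
      ext u
      simp only [Finset.mem_union, Finset.mem_sdiff, memKt]
      constructor
      · intro hu
        by_cases huK : u ∈ K
        · obtain ⟨l, rfl⟩ := (memK u).1 huK
          exact Or.inl ⟨l, (hω' l).1 hu, rfl⟩
        · exact Or.inr ⟨hu, huK⟩
      · rintro (⟨l, hl, rfl⟩ | ⟨hu, -⟩)
        · exact (hω' l).2 hl
        · exact hu
    show ∏ u ∈ ω, θ u = (∏ l, if t l = true then θ (v l) else 1) * ∏ u ∈ ω \ K, θ u
    rw [← pKt]
    conv_lhs => rw [e]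
    rw [Finset.prod_union hdisj]


/-- **Kahn's Conjecture 5 for every linear read-once first slot, product weights on `2^κ`.**  `μ(ω) = ∏_{u∈ω} θ_u`
(`θ ≥ 0`), `v : Fin (n+1) → κ` injective, `ops : Fin n → Bool` the operators of the formula
`x₀ ∘₀ (x₁ ∘₁ (⋯ ∘ₙ₋₁ xₙ))` (`∘ᵢ = ∨` iff `ops i = true`), `U' ` its set of true patterns, `A, B` arbitrary up-sets:
`0 ≤ latticeE3 μ {ω | (v i ∈ ω)ᵢ ∈ U'} A B`. [this work] -/
theorem latticeE3_nonneg_lro_prod {θ : κ → ℝ} (hθ : ∀ u, 0 ≤ θ u) (n : ℕ) (ops : Fin n → Bool)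
    {v : Fin (n + 1) → κ} (hv : Function.Injective v) {A B : Finset (Finset κ)}
    (hA : IsUpperSet (A : Set (Finset κ))) (hB : IsUpperSet (B : Set (Finset κ))) (U' : Finset (Fin (n + 1) → Bool))
    (hU' : ∀ t, t ∈ U' ↔ Fin.foldr n (fun i b => bif ops i then (t i.castSucc || b) else (t i.castSucc && b))
      (t (Fin.last n)) = true) :
    0 ≤ latticeE3 (fun ω : Finset κ => ∏ u ∈ ω, θ u)
      (univ.filter fun ω : Finset κ => (fun i => decide (v i ∈ ω)) ∈ U') A B := by
  set F : (Fin (n + 1) → Bool) → Finset (Finset κ) :=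
    fun t => univ.filter fun ω : Finset κ => ∀ l, (v l ∈ ω ↔ t l = true) with hFdef
  have hF : ∀ (t : Fin (n + 1) → Bool) (ω : Finset κ), ω ∈ F t ↔ ∀ l, (v l ∈ ω ↔ t l = true) := by
    intro t ω; simp [hFdef]
  have hF' : ∀ (t : Fin (n + 1) → Bool) (ω : Finset κ), ω ∈ F t ↔ ∀ l, (({v l} : Finset κ) ≤ ω ↔ t l = true) := by
    intro t ω; rw [hF]; simp
  set C : ℝ := ∑ ω ∈ ((univ : Finset (Fin (n + 1))).image v)ᶜ.powerset, ∏ u ∈ ω, θ u with hC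
  have hC0 : 0 ≤ C := Finset.sum_nonneg fun ω _ => Finset.prod_nonneg fun u _ => hθ u
  set w : Fin (n + 1) → Bool → ℝ := fun i b => (if b = true then θ (v i) else 1) * (if i = 0 then C else 1) with hw
  have hw0 : ∀ i b, 0 ≤ w i b := by
    intro i b; simp only [hw]
    have := hθ (v i)
    split_ifs <;> positivity
  have hν : ∀ t, mass (fun ω : Finset κ => ∏ u ∈ ω, θ u) (F t) = ∏ i, w i (t i) := by
    intro t
    rw [mass_fib_prod θ hv hF t, ← hC, hw, Finset.prod_mul_distrib, Finset.prod_ite_eq' univ (0 : Fin (n + 1))]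
    simp
  have key := SahiE3LroSlot.latticeE3_nonneg_of_lro (SahiE3HitSlotProduct.prod_nonneg' hθ)
    (SahiE3HitSlotProduct.prod_lsm θ) n ops (fun i => SahiE3CovHit.supPrime_singleton' (v i)) hF' hA hB w hw0 hν U' hU'
  have hslot : (univ.filter fun ω : Finset κ => (fun i => decide (({v i} : Finset κ) ≤ ω)) ∈ U') =
      univ.filter fun ω : Finset κ => (fun i => decide (v i ∈ ω)) ∈ U' := by
    congr 1; ext ω; simp
  rw [hslot] at key
  exact key

end Summit.CriticalPhenomena.PercolationContinuityZ3.Theorems.SahiE3LroCube
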